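import Literature.AlgebraicGeometry.Resolution.KummerNormalForm
import Literature.AlgebraicGeometry.Resolution.PCyclicBoundaryType
import Literature.AlgebraicGeometry.Resolution.RegularParameterFamilies
import Mathlib.RingTheory.IntegralClosure.IntegrallyClosed
import HarnessLib

/-!
# Giraud normal form: change of boundary equations, and the radicand is not a `p`-th power

Topic: `Literature/AlgebraicGeometry/Resolution`. Two pieces of bookkeeping for the intrinsic
Giraud normal form `GiraudNormalFormAt p x a` of the radicand of a purely inseparable
`p`-cyclic cover along an snc boundary (`KummerNormalForm.lean`; J. Giraud, *Forme normale
d'une fonction sur une surface de caractéristique positive*, Bull. SMF 111 (1983), Prop. 1.5):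

* `GiraudNormalFormAt.reindex` — the normal form only depends on the boundary COMPONENTS:
  it is unchanged when the equations `x_i` are re-enumerated and multiplied by units
  (`x_i = ε_i y_{π i}`), as happens when the form supplied at a point by `InGiraudNormalForm`
  is compared with fixed equations spread from a nearby centre
  (`IsWoundOrTransversalAt.unit_pow_mul`, `IsWoundOrTransversalAt.of_span_eq`);
* `forall_pow_ne_of_woundForm`, `forall_pow_ne_of_kummerForm` — in either alternative of the
  normal form the radicand is not a `p`-th power in the fraction field (wound/transversal:
  by normality the unit `u` would be a `p`-th power; Kummer: the `x_{j₁}`-adic valuation of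
  `a - g^p` is `A_{j₁}`, prime to `p`), so the local model `O[t]/(t^p - a)` is a domain.

Sources: [Giraud1983] J. Giraud, Bull. SMF 111 (1983), Déf. 1.2, Prop. 1.5.
-/

namespace Literature.AlgebraicGeometry.Resolution

open IsLocalRing

/-! ## Changing the boundary equations by units and re-enumeration -/

section Reindex

variable {O : Type*} [CommRing O] [IsLocalRing O] {p : ℕ}

/-- The wound-or-transversal condition is stable under multiplying `u` by the `p`-th power
of a unit. [folklore] -/
theorem IsWoundOrTransversalAt.unit_pow_mul {r : ℕ} {x : Fin r → O} {u : O}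
    (hu : IsWoundOrTransversalAt p x u) {E : O} (hE : IsUnit E) :
    IsWoundOrTransversalAt p x (E ^ p * u) := by
  have hEp : IsUnit (E ^ p) := hE.pow p
  set Einv : O := ↑(hE.unit⁻¹) with hEinv
  have hEE : E * Einv = 1 := hE.mul_val_inv
  have key : ∀ c : O, E ^ p * u - (E * c) ^ p = E ^ p * (u - c ^ p) := fun c => by ring
  have key' : ∀ c : O, E ^ p * u - c ^ p = E ^ p * (u - (Einv * c) ^ p) := fun c => by
    have : c = E * (Einv * c) := by rw [← mul_assoc, hEE, one_mul]
    conv_lhs => rw [this]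
    exact key _
  rcases hu with hw | ⟨c, hc, hc2⟩
  · refine Or.inl fun c h => hw (Einv * c) ?_
    rw [key'] at h
    exact (Ideal.unit_mul_mem_iff_mem _ hEp).mp h
  · refine Or.inr ⟨E * c, ?_, fun h => hc2 ?_⟩
    · rw [key]; exact Ideal.mul_mem_left _ _ hc
    · rw [key] at h
      exact (Ideal.unit_mul_mem_iff_mem _ hEp).mp h

/-- The wound-or-transversal condition only depends on the ideal generated by the boundary
equations. [folklore] -/
theorem IsWoundOrTransversalAt.of_span_eq {r s : ℕ} {x : Fin r → O} {y : Fin s → O} {u : O}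
    (hu : IsWoundOrTransversalAt p x u) (h : Ideal.span (Set.range x) = Ideal.span (Set.range y)) :
    IsWoundOrTransversalAt p y u := by
  rcases hu with hw | ⟨c, hc, hc2⟩
  · exact Or.inl hw
  · exact Or.inr ⟨c, hc, by rwa [← h]⟩

omit [IsLocalRing O] in
/-- If `x_i = ε_i y_{π i}` with units `ε_i` and a bijection `π`, the two families generate the
same ideal. [folklore] -/
theorem span_range_eq_of_unit_mul_reindex {r s : ℕ} {x : Fin r → O} {y : Fin s → O}
    (π : Fin r ≃ Fin s) (ε : Fin r → O) (hε : ∀ i, IsUnit (ε i)) (hxy : ∀ i, x i = ε i * y (π i)) :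
    Ideal.span (Set.range x) = Ideal.span (Set.range y) := by
  apply le_antisymm
  · refine Ideal.span_le.mpr ?_
    rintro _ ⟨i, rfl⟩
    rw [SetLike.mem_coe, hxy i]
    exact Ideal.mul_mem_left _ _ (Ideal.subset_span ⟨π i, rfl⟩)
  · refine Ideal.span_le.mpr ?_
    rintro _ ⟨k, rfl⟩
    have hk : y k = ↑((hε (π.symm k)).unit⁻¹) * x (π.symm k) := by
      rw [hxy, Equiv.apply_symm_apply, ← mul_assoc, IsUnit.val_inv_mul, one_mul]
    rw [SetLike.mem_coe, hk]
    exact Ideal.mul_mem_left _ _ (Ideal.subset_span ⟨π.symm k, rfl⟩)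

omit [IsLocalRing O] in
/-- Re-enumerating a product of powers along a bijection, with unit factors pulled out.
[folklore] -/
theorem prod_pow_unit_mul_reindex {r s : ℕ} {x : Fin r → O} {y : Fin s → O}
    (π : Fin r ≃ Fin s) (ε : Fin r → O) (hxy : ∀ i, x i = ε i * y (π i)) (B : Fin r → ℕ) :
    ∏ i, x i ^ B i = (∏ i, ε i ^ B i) * ∏ k, y k ^ B (π.symm k) := by
  have h1 : ∏ i, x i ^ B i = ∏ i, (ε i ^ B i * y (π i) ^ B i) :=
    Finset.prod_congr rfl fun i _ => by rw [hxy, mul_pow]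
  rw [h1, Finset.prod_mul_distrib]
  congr 1
  exact Fintype.prod_equiv π (fun i => y (π i) ^ B i) (fun k => y k ^ B (π.symm k))
    (fun i => by simp)

/-- **The Giraud normal form only depends on the boundary components**: it is unchanged
when the boundary equations are re-enumerated along a bijection and multiplied by units.
[cite: Giraud1983, Prop. 1.5] -/
theorem GiraudNormalFormAt.reindex {r s : ℕ} {x : Fin r → O} {y : Fin s → O} {a : O}
    (h : GiraudNormalFormAt p x a) (π : Fin r ≃ Fin s) (ε : Fin r → O)
    (hε : ∀ i, IsUnit (ε i)) (hxy : ∀ i, x i = ε i * y (π i)) : GiraudNormalFormAt p y a := by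
  have hspan := span_range_eq_of_unit_mul_reindex π ε hε hxy
  rcases h with ⟨g, u, B, hu, ha⟩ | ⟨g, A, v, ⟨j, hj⟩, ha⟩
  · have hE : IsUnit (∏ i, ε i ^ B i) := IsUnit.prod_univ_iff.mpr fun i => (hε i).pow _
    refine Or.inl ⟨g, (∏ i, ε i ^ B i) ^ p * u, fun k => B (π.symm k),
      (hu.unit_pow_mul hE).of_span_eq hspan, ?_⟩
    rw [ha, prod_pow_unit_mul_reindex π ε hxy B]
    ring
  · have hE : IsUnit (∏ i, ε i ^ A i) := IsUnit.prod_univ_iff.mpr fun i => (hε i).pow _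
    refine Or.inr ⟨g, fun k => A (π.symm k), v * hE.unit, ⟨π j, by simpa using hj⟩, ?_⟩
    rw [ha, prod_pow_unit_mul_reindex π ε hxy A, Units.val_mul, IsUnit.unit_spec]
    ring

end Reindex

/-! ## The radicand is not a `p`-th power -/

section NotPow

variable {O : Type*} [CommRing O] {K : Type*} [Field K] [Algebra O K] [IsFractionRing O K]

/-- An element of `O` with a `p`-th root in the fraction field of the normal domain `O` has a
`p`-th root in `O`. [folklore] -/
theorem exists_pow_eq_of_pow_eq_algebraMap [IsIntegrallyClosed O] {p : ℕ} (hp : p ≠ 0) {a : O}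
    {c : K} (hc : c ^ p = algebraMap O K a) : ∃ b : O, b ^ p = a := by
  have hint : IsIntegral O c := by
    refine ⟨Polynomial.X ^ p - Polynomial.C a, Polynomial.monic_X_pow_sub_C a hp, ?_⟩
    rw [Polynomial.eval₂_sub, Polynomial.eval₂_X_pow, Polynomial.eval₂_C, hc, sub_self]
  obtain ⟨b, hb⟩ := IsIntegrallyClosed.algebraMap_eq_of_integral hint
  refine ⟨b, IsFractionRing.injective O K ?_⟩
  rw [map_pow, hb, hc]

/-- **Wound/transversal form ⇒ the radicand is not a `p`-th power in the fraction field.**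
If `a = g^p + x_B^p u` in a normal domain of characteristic `p` with `x_B ≠ 0` and `u` not a
`p`-th power in `O` (e.g. `u` wound or transversal at a local `O`,
`forall_sub_pow_notMem_of_isWoundOrTransversalAt` with `𝔮 = ⊥`), then `a` is not a `p`-th
power in `Frac O`. [cite: Giraud1983, Prop. 1.5] -/
theorem forall_pow_ne_of_woundForm [IsIntegrallyClosed O] (p : ℕ) [Fact p.Prime] [CharP O p]
    {a g u xB : O} (hxB : xB ≠ 0) (hu : ∀ e : O, u ≠ e ^ p) (ha : a = g ^ p + xB ^ p * u) :
    ∀ c : K, c ^ p ≠ algebraMap O K a := by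
  have hp : p.Prime := Fact.out
  intro c hc
  obtain ⟨b, hb⟩ := exists_pow_eq_of_pow_eq_algebraMap hp.ne_zero hc
  -- `x_B^p u = (b - g)^p`, so `u = ((b - g)/x_B)^p` has a `p`-th root in `O`
  have h1 : xB ^ p * u = (b - g) ^ p := by rw [sub_pow_char, hb, ha]; ring
  have hxK : algebraMap O K xB ≠ 0 := (map_ne_zero_iff _ (IsFractionRing.injective O K)).mpr hxB
  have h2 : (algebraMap O K (b - g) / algebraMap O K xB) ^ p = algebraMap O K u := by
    rw [div_pow, ← map_pow, ← h1, map_mul, map_pow, mul_div_cancel_left₀ _ (pow_ne_zero _ hxK)]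
  obtain ⟨e, he⟩ := exists_pow_eq_of_pow_eq_algebraMap hp.ne_zero h2
  exact hu e he.symm

/-- The unit of a wound/transversal form is not a `p`-th power (in a local ring).
[folklore] -/
theorem forall_ne_pow_of_isWoundOrTransversalAt [IsLocalRing O] {p : ℕ} [Fact p.Prime] [CharP O p]
    {r : ℕ} {x : Fin r → O} {u : O}
    (hu : IsWoundOrTransversalAt p x u) : ∀ e : O, u ≠ e ^ p := by
  intro e he
  have h := forall_sub_pow_notMem_of_isWoundOrTransversalAt (𝔮 := (⊥ : Ideal O)) hu bot_le bot_le e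
  exact h (by rw [he, sub_self]; exact Ideal.zero_mem _)

/-- **Kummer form ⇒ the radicand is not a `p`-th power in the fraction field.** If
`a = g^p + v ∏ x_j^{A_j}` in a regular local ring of characteristic `p`, with `v` a unit, the
`x_j` regular parameters and some `p ∤ A_{j₁}`, then `a` is not a `p`-th power in `Frac O`:
the `x_{j₁}`-adic valuation of `a - g^p = (b - g)^p` would be `A_{j₁}`.
[cite: Giraud1983, Prop. 1.5] -/
theorem forall_pow_ne_of_kummerForm [IsRegularLocalRing O] (p : ℕ) [Fact p.Prime] [CharP O p]
    {r : ℕ} {x : Fin r → O} (hx : ∀ j, x j ∈ maximalIdeal O)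
    (hli : ∀ α : Fin r → O, ∑ i, α i * x i ∈ maximalIdeal O ^ 2 → ∀ i, α i ∈ maximalIdeal O)
    {a g v : O} (hv : IsUnit v) (A : Fin r → ℕ) {j₁ : Fin r} (hA : ¬ p ∣ A j₁)
    (ha : a = g ^ p + v * ∏ j, x j ^ A j) : ∀ c : K, c ^ p ≠ algebraMap O K a := by
  classical
  have hp : p.Prime := Fact.out
  haveI := isDomain_of_isRegularLocalRing O
  haveI := isIntegrallyClosed_of_isRegularLocalRing O
  intro c hc
  obtain ⟨b, hb⟩ := exists_pow_eq_of_pow_eq_algebraMap hp.ne_zero hc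
  have hprime : Prime (x j₁) := RegularParameters.prime_apply hx hli j₁
  -- `(v ∏ x^A) · 1^p = (b - g)^p`
  have h1 : (v * x j₁ ^ A j₁ * ∏ i ∈ Finset.univ.erase j₁, x i ^ A i) * 1 ^ p = (b - g) ^ p := by
    rw [one_pow, mul_one, mul_assoc, Finset.mul_prod_erase _ (fun i => x i ^ A i) (Finset.mem_univ j₁),
      sub_pow_char, hb, ha]
    ring
  have hmult := emultiplicity_unit_mul_pow_mul_prod hprime hv (A j₁) (Finset.univ.erase j₁) x A
    (fun i hi h => RegularParameters.notMem_sq_sup_span_singleton hli (Finset.ne_of_mem_erase hi)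
      (Ideal.mem_sup_right (Ideal.mem_span_singleton.mpr h)))
  exact hA (dvd_multiplicity_of_mul_pow_eq_pow hprime hp.ne_zero one_ne_zero h1 hmult)

end NotPow

end Literature.AlgebraicGeometry.Resolution
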